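import Summits.RiemannHypothesis.RiemannHypothesis.Theorems.WeilFormatCDataO91TabValid1
import Summits.RiemannHypothesis.RiemannHypothesis.Theorems.WeilFormatCDataO91TabValid2
import Summits.RiemannHypothesis.RiemannHypothesis.Theorems.WeilFormatCDataO91TabValid3
import Summits.RiemannHypothesis.RiemannHypothesis.Theorems.WeilFormatCDataO91TabValid4
import Summits.RiemannHypothesis.RiemannHypothesis.Theorems.WeilFormatCDataO91TabValid
import Summits.RiemannHypothesis.RiemannHypothesis.Theorems.WeilFormatCDataO91ColSlice0
import Summits.RiemannHypothesis.RiemannHypothesis.Theorems.WeilFormatCDataO91ColSlice1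
import Summits.RiemannHypothesis.RiemannHypothesis.Theorems.WeilFormatCDataO91ColSlice2
import Summits.RiemannHypothesis.RiemannHypothesis.Theorems.WeilFormatCDataO91ColSlice3
import Summits.RiemannHypothesis.RiemannHypothesis.Theorems.WeilFormatCDataO91ColSlice4
import Summits.RiemannHypothesis.RiemannHypothesis.Theorems.WeilFormatCDataO91ColSlice5
import Summits.RiemannHypothesis.RiemannHypothesis.Theorems.WeilFormatCDataO91ColSlice6
import Summits.RiemannHypothesis.RiemannHypothesis.Theorems.WeilFormatCDataO91ColSlice7
import Summits.RiemannHypothesis.RiemannHypothesis.Theorems.WeilFormatCDataO91ColSlice8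
import Summits.RiemannHypothesis.RiemannHypothesis.Theorems.WeilFormatCDataO91ColSlice9
import Summits.RiemannHypothesis.RiemannHypothesis.Theorems.WeilFormatCDataO91ColSlice10
import Summits.RiemannHypothesis.RiemannHypothesis.Theorems.WeilFormatCDataO91ColSlice11
import Summits.RiemannHypothesis.RiemannHypothesis.Theorems.WeilFormatCDataO91ColSlice12
import Summits.RiemannHypothesis.RiemannHypothesis.Theorems.WeilFormatCDataO91ColSlice13
import Summits.RiemannHypothesis.RiemannHypothesis.Theorems.WeilFormatCDataO91ColSlice14
import Summits.RiemannHypothesis.RiemannHypothesis.Theorems.WeilFormatCDataO91Front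
import Summits.RiemannHypothesis.RiemannHypothesis.Theorems.WeilFormatCDataO91FrontW1
import Summits.RiemannHypothesis.RiemannHypothesis.Theorems.WeilFormatCDataO91FrontW2
import Summits.RiemannHypothesis.RiemannHypothesis.Theorems.WeilFormatCDataA1RungCB
import Summits.RiemannHypothesis.RiemannHypothesis.Theorems.WeilFormatCDataO91Mid
import Summits.RiemannHypothesis.RiemannHypothesis.Theorems.WeilFormatCDataO91CBOddCols0
import Summits.RiemannHypothesis.RiemannHypothesis.Theorems.WeilFormatCDataO91CBOddCols1
import Summits.RiemannHypothesis.RiemannHypothesis.Theorems.WeilFormatCDataO91CBOddCols2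
import Summits.RiemannHypothesis.RiemannHypothesis.Theorems.WeilFormatCDataO91CBOddCols3
import Summits.RiemannHypothesis.RiemannHypothesis.Theorems.WeilFormatCDataO91CBOddCols4
import Summits.RiemannHypothesis.RiemannHypothesis.Theorems.WeilFormatCDataO91CBOddTailPsi0
import Summits.RiemannHypothesis.RiemannHypothesis.Theorems.WeilFormatCDataO91CBOddTail
import Summits.RiemannHypothesis.RiemannHypothesis.Theorems.WeilFormatCDataO91CBOddSchur0
import Summits.RiemannHypothesis.RiemannHypothesis.Theorems.WeilFormatCDataO91CBOddSchur1
import Summits.RiemannHypothesis.RiemannHypothesis.Theorems.WeilFormatCDataO91CBOddSchur2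
import Summits.RiemannHypothesis.RiemannHypothesis.Theorems.WeilFormatCDataO91CBOddSchur3
import Summits.RiemannHypothesis.RiemannHypothesis.Theorems.WeilFormatCDataO91CBOddSchur4
import Summits.RiemannHypothesis.RiemannHypothesis.Theorems.WeilFormatCDataO91CBOddSchur5
import Summits.RiemannHypothesis.RiemannHypothesis.Theorems.WeilFormatCDataO91CBOddSchur6
import Summits.RiemannHypothesis.RiemannHypothesis.Theorems.WeilFormatCDataO91CBOddSchur7
import Summits.RiemannHypothesis.RiemannHypothesis.Theorems.WeilFormatCDataO91CBOddSchur8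
import Summits.RiemannHypothesis.RiemannHypothesis.Theorems.WeilFormatCDataO91CBOddSchur9
import Summits.RiemannHypothesis.RiemannHypothesis.Theorems.WeilFormatCDataO91CBOddSchur10
import Summits.RiemannHypothesis.RiemannHypothesis.Theorems.WeilFormatCDataO91CBOddSchur11
import Summits.RiemannHypothesis.RiemannHypothesis.Theorems.WeilFormatCDataO91CBOddSchur12
import Summits.RiemannHypothesis.RiemannHypothesis.Theorems.WeilFormatCDataO91CBOddSchur13
import Summits.RiemannHypothesis.RiemannHypothesis.Theorems.WeilFormatCDataO91CBOddSchur14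
import Summits.RiemannHypothesis.RiemannHypothesis.Theorems.WeilFormatCDataO91CBOddSchur15
import Summits.RiemannHypothesis.RiemannHypothesis.Theorems.WeilFormatCDataO91CBOddSchur16
import Summits.RiemannHypothesis.RiemannHypothesis.Theorems.WeilFormatCDataO91CBOddPsd0
import Summits.RiemannHypothesis.RiemannHypothesis.Theorems.WeilFormatCDataO91CBOddPsd1
import Summits.RiemannHypothesis.RiemannHypothesis.Theorems.WeilFormatCDataO91CBOddPsd2
import Summits.RiemannHypothesis.RiemannHypothesis.Theorems.WeilFormatCDataO91CBOddPsd3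
import Summits.RiemannHypothesis.RiemannHypothesis.Theorems.S2FormatCE0
import Literature.NumberTheory.LFunctions.YoshidaWindowGramTailMSSines
import Literature.NumberTheory.LFunctions.YoshidaWindowGramMiddleJBox
import Literature.NumberTheory.LFunctions.YoshidaWindowGramTailJFactoredScaled
import Literature.NumberTheory.LFunctions.YoshidaWindowGramTailMSFactored
import Literature.NumberTheory.LFunctions.YoshidaWindowGramTailJDiagTight
import Summits.RiemannHypothesis.RiemannHypothesis.Theorems.FormatCPsdBands
import Summits.RiemannHypothesis.RiemannHypothesis.Theorems.WeilFormatCDiagShift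
import HarnessLib
import Summits.RiemannHypothesis.RiemannHypothesis.Theorems.WeilFormatCDataO91OddAsmA

/-!
# Format C kernel rung `O91` (a = 91/100, column-band layout): ASSEMBLY of the flat layout, part B of 5 (ladders of TabValid4, TabValid; split of the 1286-line assembly at block boundaries by prover B g18 for the 400-line cap; blocks byte-identical): every propositional ladder of the kernel files (table/column validity, front door, sines, middle moments, column data, tail factors, Schur rows, (P) + diagonal shift), byte-identical statements and proofs, original order (A g22 restage_flat.py; weil-2 KERNEL-CHAIN-RULES #1)

Window `a = 91/100`; prime powers in the window: 2, 3, 2^2, 5; prime constant A = 1825/1000 (`WeilFormatC.primeCoeff_form_ge_cells_09729`); evaluator parameters S = 2^256, Kpi 130, Kser 150, kred 8, Kexp 45, J 120; full table modes < 161; light column table modes < 1027; units 2^-250 (Schur entries), 2^-124 (column digits, width 127), 2^-118 (tail-factor digits, width 121), 2^-64 (reciprocal weights), 2^-40 (tail base); order-J tail J = 4, θ = 1/2048, η = 1/10 | 4/1.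
Design row: sr-gb-rung-a odd λ-run (parity cell 9 L-side): a = 91/100, μ = 2·LAMZ·2^-250 (LAMZ=7662477704329444291791735135751545918093695610918010880), odd 160/320/1024, MS tail; see HOME(A)/LADDER-LSIDES-FORMATC-A-g22.md. Generated by sr-gb-rung-a prover A g22 with rh-explicit-weil-2 gen7's generator extended for the odd λ-run (--sector odd --mu-log2; HOME(A)/code-g22/gen7/gramgen7.py sha16 0aa3348087f4e84e) from `#eval` of the tree's `Encl` functions; every datum is re-verified by the kernel in the theorem files (`decide +kernel`). Helper data of the rh-explicit Weil-positivity programme (format C, K-CELL-2), RH-free. [cite: Yoshida1992HermitianForms, §5 (5.15)-(5.16) p. 301; §7 pp. 305–312]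
-/

set_option linter.dupNamespace false
set_option maxRecDepth 200000

-- ===== from WeilFormatCDataO91TabValid4 =====
namespace Summit.RiemannHypothesis.RiemannHypothesis.Theorems.WeilFormatCData.O91
open Literature.NumberTheory.LFunctions Literature.NumberTheory.LFunctions.Yoshida1992 Encl Literature.Analysis.ValidatedNumerics.NumericsMP

/-- the special-value table is valid below `134` (partial). -/
theorem tabv134 : TabValid (2 ^ 256) O91.a O91.ks 134 O91.tab := by
  have h98 : TabValid (2 ^ 256) a ks 98 tab := tabv98
  have h99 : TabValid (2 ^ 256) a ks (98 + 1) tab :=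
    h98.extend fun n hn hnk ↦ idxValid_of_checkTable (prm := prm) (by norm_num [prm]) a_pos consts_valid tT98 hn hnk
  have h100 : TabValid (2 ^ 256) a ks (99 + 1) tab :=
    h99.extend fun n hn hnk ↦ idxValid_of_checkTable (prm := prm) (by norm_num [prm]) a_pos consts_valid tT99 hn hnk
  have h101 : TabValid (2 ^ 256) a ks (100 + 1) tab :=
    h100.extend fun n hn hnk ↦ idxValid_of_checkTable (prm := prm) (by norm_num [prm]) a_pos consts_valid tT100 hn hnk
  have h102 : TabValid (2 ^ 256) a ks (101 + 1) tab :=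
    h101.extend fun n hn hnk ↦ idxValid_of_checkTable (prm := prm) (by norm_num [prm]) a_pos consts_valid tT101 hn hnk
  have h103 : TabValid (2 ^ 256) a ks (102 + 1) tab :=
    h102.extend fun n hn hnk ↦ idxValid_of_checkTable (prm := prm) (by norm_num [prm]) a_pos consts_valid tT102 hn hnk
  have h104 : TabValid (2 ^ 256) a ks (103 + 1) tab :=
    h103.extend fun n hn hnk ↦ idxValid_of_checkTable (prm := prm) (by norm_num [prm]) a_pos consts_valid tT103 hn hnk
  have h105 : TabValid (2 ^ 256) a ks (104 + 1) tab :=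
    h104.extend fun n hn hnk ↦ idxValid_of_checkTable (prm := prm) (by norm_num [prm]) a_pos consts_valid tT104 hn hnk
  have h106 : TabValid (2 ^ 256) a ks (105 + 1) tab :=
    h105.extend fun n hn hnk ↦ idxValid_of_checkTable (prm := prm) (by norm_num [prm]) a_pos consts_valid tT105 hn hnk
  have h107 : TabValid (2 ^ 256) a ks (106 + 1) tab :=
    h106.extend fun n hn hnk ↦ idxValid_of_checkTable (prm := prm) (by norm_num [prm]) a_pos consts_valid tT106 hn hnk
  have h108 : TabValid (2 ^ 256) a ks (107 + 1) tab :=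
    h107.extend fun n hn hnk ↦ idxValid_of_checkTable (prm := prm) (by norm_num [prm]) a_pos consts_valid tT107 hn hnk
  have h109 : TabValid (2 ^ 256) a ks (108 + 1) tab :=
    h108.extend fun n hn hnk ↦ idxValid_of_checkTable (prm := prm) (by norm_num [prm]) a_pos consts_valid tT108 hn hnk
  have h110 : TabValid (2 ^ 256) a ks (109 + 1) tab :=
    h109.extend fun n hn hnk ↦ idxValid_of_checkTable (prm := prm) (by norm_num [prm]) a_pos consts_valid tT109 hn hnk
  have h111 : TabValid (2 ^ 256) a ks (110 + 1) tab :=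
    h110.extend fun n hn hnk ↦ idxValid_of_checkTable (prm := prm) (by norm_num [prm]) a_pos consts_valid tT110 hn hnk
  have h112 : TabValid (2 ^ 256) a ks (111 + 1) tab :=
    h111.extend fun n hn hnk ↦ idxValid_of_checkTable (prm := prm) (by norm_num [prm]) a_pos consts_valid tT111 hn hnk
  have h113 : TabValid (2 ^ 256) a ks (112 + 1) tab :=
    h112.extend fun n hn hnk ↦ idxValid_of_checkTable (prm := prm) (by norm_num [prm]) a_pos consts_valid tT112 hn hnk
  have h114 : TabValid (2 ^ 256) a ks (113 + 1) tab :=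
    h113.extend fun n hn hnk ↦ idxValid_of_checkTable (prm := prm) (by norm_num [prm]) a_pos consts_valid tT113 hn hnk
  have h115 : TabValid (2 ^ 256) a ks (114 + 1) tab :=
    h114.extend fun n hn hnk ↦ idxValid_of_checkTable (prm := prm) (by norm_num [prm]) a_pos consts_valid tT114 hn hnk
  have h116 : TabValid (2 ^ 256) a ks (115 + 1) tab :=
    h115.extend fun n hn hnk ↦ idxValid_of_checkTable (prm := prm) (by norm_num [prm]) a_pos consts_valid tT115 hn hnk
  have h117 : TabValid (2 ^ 256) a ks (116 + 1) tab :=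
    h116.extend fun n hn hnk ↦ idxValid_of_checkTable (prm := prm) (by norm_num [prm]) a_pos consts_valid tT116 hn hnk
  have h118 : TabValid (2 ^ 256) a ks (117 + 1) tab :=
    h117.extend fun n hn hnk ↦ idxValid_of_checkTable (prm := prm) (by norm_num [prm]) a_pos consts_valid tT117 hn hnk
  have h119 : TabValid (2 ^ 256) a ks (118 + 1) tab :=
    h118.extend fun n hn hnk ↦ idxValid_of_checkTable (prm := prm) (by norm_num [prm]) a_pos consts_valid tT118 hn hnk
  have h120 : TabValid (2 ^ 256) a ks (119 + 1) tab :=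
    h119.extend fun n hn hnk ↦ idxValid_of_checkTable (prm := prm) (by norm_num [prm]) a_pos consts_valid tT119 hn hnk
  have h121 : TabValid (2 ^ 256) a ks (120 + 1) tab :=
    h120.extend fun n hn hnk ↦ idxValid_of_checkTable (prm := prm) (by norm_num [prm]) a_pos consts_valid tT120 hn hnk
  have h122 : TabValid (2 ^ 256) a ks (121 + 1) tab :=
    h121.extend fun n hn hnk ↦ idxValid_of_checkTable (prm := prm) (by norm_num [prm]) a_pos consts_valid tT121 hn hnk
  have h123 : TabValid (2 ^ 256) a ks (122 + 1) tab :=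
    h122.extend fun n hn hnk ↦ idxValid_of_checkTable (prm := prm) (by norm_num [prm]) a_pos consts_valid tT122 hn hnk
  have h124 : TabValid (2 ^ 256) a ks (123 + 1) tab :=
    h123.extend fun n hn hnk ↦ idxValid_of_checkTable (prm := prm) (by norm_num [prm]) a_pos consts_valid tT123 hn hnk
  have h125 : TabValid (2 ^ 256) a ks (124 + 1) tab :=
    h124.extend fun n hn hnk ↦ idxValid_of_checkTable (prm := prm) (by norm_num [prm]) a_pos consts_valid tT124 hn hnk
  have h126 : TabValid (2 ^ 256) a ks (125 + 1) tab :=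
    h125.extend fun n hn hnk ↦ idxValid_of_checkTable (prm := prm) (by norm_num [prm]) a_pos consts_valid tT125 hn hnk
  have h127 : TabValid (2 ^ 256) a ks (126 + 1) tab :=
    h126.extend fun n hn hnk ↦ idxValid_of_checkTable (prm := prm) (by norm_num [prm]) a_pos consts_valid tT126 hn hnk
  have h128 : TabValid (2 ^ 256) a ks (127 + 1) tab :=
    h127.extend fun n hn hnk ↦ idxValid_of_checkTable (prm := prm) (by norm_num [prm]) a_pos consts_valid tT127 hn hnk
  have h129 : TabValid (2 ^ 256) a ks (128 + 1) tab :=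
    h128.extend fun n hn hnk ↦ idxValid_of_checkTable (prm := prm) (by norm_num [prm]) a_pos consts_valid tT128 hn hnk
  have h130 : TabValid (2 ^ 256) a ks (129 + 1) tab :=
    h129.extend fun n hn hnk ↦ idxValid_of_checkTable (prm := prm) (by norm_num [prm]) a_pos consts_valid tT129 hn hnk
  have h131 : TabValid (2 ^ 256) a ks (130 + 1) tab :=
    h130.extend fun n hn hnk ↦ idxValid_of_checkTable (prm := prm) (by norm_num [prm]) a_pos consts_valid tT130 hn hnk
  have h132 : TabValid (2 ^ 256) a ks (131 + 1) tab :=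
    h131.extend fun n hn hnk ↦ idxValid_of_checkTable (prm := prm) (by norm_num [prm]) a_pos consts_valid tT131 hn hnk
  have h133 : TabValid (2 ^ 256) a ks (132 + 1) tab :=
    h132.extend fun n hn hnk ↦ idxValid_of_checkTable (prm := prm) (by norm_num [prm]) a_pos consts_valid tT132 hn hnk
  have h134 : TabValid (2 ^ 256) a ks (133 + 1) tab :=
    h133.extend fun n hn hnk ↦ idxValid_of_checkTable (prm := prm) (by norm_num [prm]) a_pos consts_valid tT133 hn hnk
  exact h134

end Summit.RiemannHypothesis.RiemannHypothesis.Theorems.WeilFormatCData.O91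

-- ===== from WeilFormatCDataO91TabValid =====
namespace Summit.RiemannHypothesis.RiemannHypothesis.Theorems.WeilFormatCData.O91
open Literature.NumberTheory.LFunctions Literature.NumberTheory.LFunctions.Yoshida1992 Encl Literature.Analysis.ValidatedNumerics.NumericsMP

/-- the special-value table is valid below `161`. -/
theorem tab_valid : TabValid (2 ^ 256) O91.a O91.ks 161 O91.tab := by
  have h134 : TabValid (2 ^ 256) a ks 134 tab := tabv134
  have h135 : TabValid (2 ^ 256) a ks (134 + 1) tab :=
    h134.extend fun n hn hnk ↦ idxValid_of_checkTable (prm := prm) (by norm_num [prm]) a_pos consts_valid tT134 hn hnk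
  have h136 : TabValid (2 ^ 256) a ks (135 + 1) tab :=
    h135.extend fun n hn hnk ↦ idxValid_of_checkTable (prm := prm) (by norm_num [prm]) a_pos consts_valid tT135 hn hnk
  have h137 : TabValid (2 ^ 256) a ks (136 + 1) tab :=
    h136.extend fun n hn hnk ↦ idxValid_of_checkTable (prm := prm) (by norm_num [prm]) a_pos consts_valid tT136 hn hnk
  have h138 : TabValid (2 ^ 256) a ks (137 + 1) tab :=
    h137.extend fun n hn hnk ↦ idxValid_of_checkTable (prm := prm) (by norm_num [prm]) a_pos consts_valid tT137 hn hnk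
  have h139 : TabValid (2 ^ 256) a ks (138 + 1) tab :=
    h138.extend fun n hn hnk ↦ idxValid_of_checkTable (prm := prm) (by norm_num [prm]) a_pos consts_valid tT138 hn hnk
  have h140 : TabValid (2 ^ 256) a ks (139 + 1) tab :=
    h139.extend fun n hn hnk ↦ idxValid_of_checkTable (prm := prm) (by norm_num [prm]) a_pos consts_valid tT139 hn hnk
  have h141 : TabValid (2 ^ 256) a ks (140 + 1) tab :=
    h140.extend fun n hn hnk ↦ idxValid_of_checkTable (prm := prm) (by norm_num [prm]) a_pos consts_valid tT140 hn hnk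
  have h142 : TabValid (2 ^ 256) a ks (141 + 1) tab :=
    h141.extend fun n hn hnk ↦ idxValid_of_checkTable (prm := prm) (by norm_num [prm]) a_pos consts_valid tT141 hn hnk
  have h143 : TabValid (2 ^ 256) a ks (142 + 1) tab :=
    h142.extend fun n hn hnk ↦ idxValid_of_checkTable (prm := prm) (by norm_num [prm]) a_pos consts_valid tT142 hn hnk
  have h144 : TabValid (2 ^ 256) a ks (143 + 1) tab :=
    h143.extend fun n hn hnk ↦ idxValid_of_checkTable (prm := prm) (by norm_num [prm]) a_pos consts_valid tT143 hn hnk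
  have h145 : TabValid (2 ^ 256) a ks (144 + 1) tab :=
    h144.extend fun n hn hnk ↦ idxValid_of_checkTable (prm := prm) (by norm_num [prm]) a_pos consts_valid tT144 hn hnk
  have h146 : TabValid (2 ^ 256) a ks (145 + 1) tab :=
    h145.extend fun n hn hnk ↦ idxValid_of_checkTable (prm := prm) (by norm_num [prm]) a_pos consts_valid tT145 hn hnk
  have h147 : TabValid (2 ^ 256) a ks (146 + 1) tab :=
    h146.extend fun n hn hnk ↦ idxValid_of_checkTable (prm := prm) (by norm_num [prm]) a_pos consts_valid tT146 hn hnk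
  have h148 : TabValid (2 ^ 256) a ks (147 + 1) tab :=
    h147.extend fun n hn hnk ↦ idxValid_of_checkTable (prm := prm) (by norm_num [prm]) a_pos consts_valid tT147 hn hnk
  have h149 : TabValid (2 ^ 256) a ks (148 + 1) tab :=
    h148.extend fun n hn hnk ↦ idxValid_of_checkTable (prm := prm) (by norm_num [prm]) a_pos consts_valid tT148 hn hnk
  have h150 : TabValid (2 ^ 256) a ks (149 + 1) tab :=
    h149.extend fun n hn hnk ↦ idxValid_of_checkTable (prm := prm) (by norm_num [prm]) a_pos consts_valid tT149 hn hnk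
  have h151 : TabValid (2 ^ 256) a ks (150 + 1) tab :=
    h150.extend fun n hn hnk ↦ idxValid_of_checkTable (prm := prm) (by norm_num [prm]) a_pos consts_valid tT150 hn hnk
  have h152 : TabValid (2 ^ 256) a ks (151 + 1) tab :=
    h151.extend fun n hn hnk ↦ idxValid_of_checkTable (prm := prm) (by norm_num [prm]) a_pos consts_valid tT151 hn hnk
  have h153 : TabValid (2 ^ 256) a ks (152 + 1) tab :=
    h152.extend fun n hn hnk ↦ idxValid_of_checkTable (prm := prm) (by norm_num [prm]) a_pos consts_valid tT152 hn hnk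
  have h154 : TabValid (2 ^ 256) a ks (153 + 1) tab :=
    h153.extend fun n hn hnk ↦ idxValid_of_checkTable (prm := prm) (by norm_num [prm]) a_pos consts_valid tT153 hn hnk
  have h155 : TabValid (2 ^ 256) a ks (154 + 1) tab :=
    h154.extend fun n hn hnk ↦ idxValid_of_checkTable (prm := prm) (by norm_num [prm]) a_pos consts_valid tT154 hn hnk
  have h156 : TabValid (2 ^ 256) a ks (155 + 1) tab :=
    h155.extend fun n hn hnk ↦ idxValid_of_checkTable (prm := prm) (by norm_num [prm]) a_pos consts_valid tT155 hn hnk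
  have h157 : TabValid (2 ^ 256) a ks (156 + 1) tab :=
    h156.extend fun n hn hnk ↦ idxValid_of_checkTable (prm := prm) (by norm_num [prm]) a_pos consts_valid tT156 hn hnk
  have h158 : TabValid (2 ^ 256) a ks (157 + 1) tab :=
    h157.extend fun n hn hnk ↦ idxValid_of_checkTable (prm := prm) (by norm_num [prm]) a_pos consts_valid tT157 hn hnk
  have h159 : TabValid (2 ^ 256) a ks (158 + 1) tab :=
    h158.extend fun n hn hnk ↦ idxValid_of_checkTable (prm := prm) (by norm_num [prm]) a_pos consts_valid tT158 hn hnk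
  have h160 : TabValid (2 ^ 256) a ks (159 + 1) tab :=
    h159.extend fun n hn hnk ↦ idxValid_of_checkTable (prm := prm) (by norm_num [prm]) a_pos consts_valid tT159 hn hnk
  have h161 : TabValid (2 ^ 256) a ks (160 + 1) tab :=
    h160.extend fun n hn hnk ↦ idxValid_of_checkTable (prm := prm) (by norm_num [prm]) a_pos consts_valid tT160 hn hnk
  exact h161

/-- full table for the odd rows. -/
theorem tab_valid_odd : TabValid (2 ^ 256) O91.a O91.ks (160 + 1) O91.tab := fun n hn ↦ tab_valid n (by omega)

end Summit.RiemannHypothesis.RiemannHypothesis.Theorems.WeilFormatCData.O91
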